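import Mathlib
import HarnessLib
import Literature.MathematicalPhysics.StatisticalMechanics.RenormalisationMapDecompositionFreeHt
import Literature.MathematicalPhysics.StatisticalMechanics.RenormalisationMapBallActivityABKMQ

/-!
# `K_{k+1}` with a FREE intermediate Hamiltonian is `C^{r₀}` in the field ([ABKM19] Definition 6.5 (6.34), torus data)

Twin of `contDiff_nextKStep_abkm_of_stepKernelBounds` (`RenormalisationMapBallActivityABKMQ`) for
`nextK s π μ_{k+1} (e^{−H}) (e^{−H̃}) K` with `H̃` FREE: on `U = ∅` the functional is the constant `1`; on `U ≠ ∅` it is the sum of the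
free-`H̃` decomposition (`RenormalisationMapDecompositionFreeHt.nextK_freeHt_eq_blockPart_add_remainders_abkm_of_stepKernelBounds`)
whose pieces are `C^{r₀}` (`contDiff_blockPart/blockSummand/reblockTop/reblockSub_abkm_of_stepKernelBounds`, each with a free
prefactor Hamiltonian) and whose defect is a finite sum of products of exponentials of block Hamiltonians.  This is the per-`σ`
smoothness input (`hKc`) of the Cauchy engines `weakNormLE_sub/secondDiff_of_pointwise_holomorphic` for the blocks B1–B3 of the stub
`stub_f4l2ShrinkLoc` of the route `Summits/HubbardSuperconductivity/…/Theses/ComplexGFFStiffness`.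

* `nextK_freeHt_empty` — `nextK … (e^{−H̃}) K ∅ φ = 1` (`K(∅) = 1`);
* `contDiff_nextK_freeHt_abkm_of_stepKernelBounds`.

Everything is proved; no named fact.  Honest scope: rung route (stiffness of a complex Gaussian gradient field via the [ABKM19] RG);
nothing about superconductivity in the Hubbard model.

## References
* S. Adams, S. Buchholz, R. Kotecký, S. Müller, arXiv:1910.13564, Definition 6.5 (6.34), Theorem 6.8, Ch. 9.1, Ch. 10.1
  [AdamsBuchholzKoteckyMuller2019].
-/

noncomputable section

namespace Literature.MathematicalPhysics.StatisticalMechanics.GradientRG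

open scoped BigOperators Classical
open Finset MeasureTheory
open Literature.MathematicalPhysics.StatisticalMechanics.TorusPolymer
  (IsPolymer blocks polys bprod blockOf thicken reblock boxCorner mem_polys mem_blocks numBlocks isPolymer_blockOf
    card_blocks_eq_numBlocks blocks_blockOf empty_mem_polys closure mem_blockOf_self reblock_eq_empty_iff)
open Literature.Barriers.CriticalPhenomena.LongRangePhi4.Polymer (IsConn components)
open Literature.MathematicalPhysics.StatisticalMechanics.GradientFRD (iterDiff)
open Literature.MathematicalPhysics.QuantumFieldTheory

variable {d M : ℕ} [NeZero M]

/-- **`nextK s π μ (e^{−H}) (e^{−H̃}) K ∅ φ = 1`** when `K(∅) = 1` (the only `π`-preimage of `∅` is `∅`, `Φ(∅) = K(∅) = 1`,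
`μ` a probability measure). [cite: AdamsBuchholzKoteckyMuller2019, Definition 6.5 (6.34) / Lemma 6.4 (4)] -/
theorem nextK_freeHt_empty (D : StepData d M) (H Ht : RelevantHamiltonian ℂ d)
    {K : Finset (Fin d → ZMod M) → ((Fin d → ZMod M) → ℝ) → ℂ} (hK : ∀ φ, K ∅ φ = 1)
    (φ : (Fin d → ZMod M) → ℝ) :
    nextK D.s (reblock D.s (D.L * D.s)) (stepMeasure D.𝒞) (expNegH H) (expNegH Ht) K ∅ φ = 1 := by
  haveI := isProbabilityMeasure_stepMeasure D.𝒞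
  unfold nextK
  have hfilter : (polys D.s (univ : Finset (Fin d → ZMod M))).filter
      (fun X => reblock D.s (D.L * D.s) X = ∅) = {∅} := by
    ext X
    rw [mem_filter, mem_singleton, reblock_eq_empty_iff]
    exact ⟨fun h => h.2, fun h => ⟨h ▸ empty_mem_polys D.s _, h⟩⟩
  rw [hfilter, sum_singleton]
  simp [hK, midK, TorusPolymer.pcirc, polys_empty, TorusPolymer.bprod_empty]

set_option maxHeartbeats 800000 in
/-- **`U ↦ nextK(μ_D; e^{−H}, e^{−H̃}, K)(U, ·)` is `C^{r₀}`** for the torus step data (`D.s = L^k`, `D.L = L`, `StepKernelBounds`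
for `D.𝒞`), `‖H‖_{k,0} ≤ 1/8`, admissible `K` with `K(∅) = 1`, and ANY relevant Hamiltonian `H̃` in the intermediate slot.
[cite: AdamsBuchholzKoteckyMuller2019, Definition 6.5 (6.34) / Theorem 6.8] -/
theorem contDiff_nextK_freeHt_abkm_of_stepKernelBounds {L N Mord R n p r₀ : ℕ} {θbar lam μ δ₁ δ₀ A𝒫 A𝒫' C₂ h A : ℝ}
    {𝒞 : ℕ → (Fin d → ZMod M) → ℝ} (hd : 3 ≤ d) (hLodd : Odd L) (hL : 2 ^ (d + 3) + 16 * R ≤ L)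
    (hM : M = L ^ N) {k : ℕ} (hkN : k + 1 ≤ N) (hp : d / 2 + 2 ≤ p) (hpM : p + d ≤ Mord) (hMR : Mord ≤ R)
    (hB : AbkmWeightBounds L N Mord R n θbar lam μ δ₁ δ₀ A𝒫 𝒞
      (abkmWeightData L N Mord R θbar (schedDelta δ₀ δ₁ N) 𝒞))
    (hδ₀ : 0 < δ₀) (hδ₁ : 0 < δ₁) (hh : 0 < h) (hh0 : hZeroSq d R δ₀ δ₁ ≤ h ^ 2) (hA1 : 1 ≤ A)
    (D : StepData d M) (hDs : D.s = L ^ k) (hDL : D.L = L) (hS : StepKernelBounds (abkmWeightData L N Mord R θbar (schedDelta δ₀ δ₁ N) 𝒞) L k A𝒫' C₂ D.𝒞)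
    {x₀ : Fin d → ZMod M} (hB₀ : D.B₀ = blockOf (L ^ k) x₀) (hc₀ : D.c₀ = boxCorner (L ^ k) (starRad R L d k) x₀)
    {H : RelevantHamiltonian ℂ d} (hH : hamNorm (fieldWt h (L : ℝ) d k) ((L : ℝ) ^ k) (L ^ (d * k)) H ≤ 1 / 8)
    (Ht : RelevantHamiltonian ℂ d)
    {K : Finset (Fin d → ZMod M) → ((Fin d → ZMod M) → ℝ) → ℂ} {C : ℝ} (hC : 0 ≤ C)
    (hK : WeakNormLE (abkmNormParams L N Mord R p r₀ h θbar A (schedDelta δ₀ δ₁ N) 𝒞) k K C)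
    (hKfac : Factorises (L ^ k) K) (hK0 : ∀ φ, K ∅ φ = 1) (hKd : ∀ Y, ContDiff ℝ r₀ (K Y))
    (hKloc : ∀ Y, IsPolymer (L ^ k) Y → IsConn Y → IsGaugeLocal ((abkmNormParams L N Mord R p r₀ h θbar A (schedDelta δ₀ δ₁ N) 𝒞).gauge k Y) (K Y))
    (U : Finset (Fin d → ZMod M)) :
    ContDiff ℝ r₀ (nextK D.s (reblock D.s (D.L * D.s)) (stepMeasure D.𝒞) (expNegH H) (expNegH Ht) K U) := by
  by_cases hUe : U = ∅
  · subst hUe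
    have : nextK D.s (reblock D.s (D.L * D.s)) (stepMeasure D.𝒞) (expNegH H) (expNegH Ht) K ∅ = fun _ => (1 : ℂ) :=
      funext (nextK_freeHt_empty D H Ht hK0)
    rw [this]; exact contDiff_const
  have hUne : U.Nonempty := Finset.nonempty_iff_ne_empty.2 hUe
  have hd2 : 2 ≤ d := by omega
  have hp1 : d / 2 + 1 ≤ p := by omega
  have hpR : p ≤ R := by omega
  have hMord : d / 2 + 1 ≤ Mord := by omega
  have hA0 : 0 < A := by linarith
  have hk1 : k + 1 ≤ N + 1 := by omega
  have hUk : ∀ X ∈ ((polys (L ^ k) univ).filter (fun X => reblock (L ^ k) (L * L ^ k) X = U)), IsPolymer (L ^ k) X :=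
    fun X hX => (mem_polys.1 (mem_filter.1 hX).1).2
  have hblk : ∀ B ∈ blockPartIndex D U, ∃ y, B = blockOf (L ^ k) y := fun B hB' => by
    have hBb := blockPartIndex_subset_blocks D U hB'
    rw [hDs] at hBb
    obtain ⟨y, -, rfl⟩ := mem_blocks.1 hBb
    exact ⟨y, rfl⟩
  have hF0d : ContDiff ℝ r₀ (fun φ => blockPart D K U φ) :=
    contDiff_blockPart_abkm_of_stepKernelBounds hB hLodd hM hA0 D hDs hS hC hK hKd hKloc U
  have hF1d : ContDiff ℝ r₀ (fun φ => ∑ B ∈ blockPartIndex D U,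
        ((bprod (L ^ k) (fun B' => expNegH (Ht) B' φ) (U \ B) *
              bprod (L ^ k) (fun B' => expNegH (-(Ht)) B' φ) (B \ U) - 1) * blockTerm D K B φ +
          bprod (L ^ k) (fun B' => expNegH (Ht) B' φ) (U \ B) *
              bprod (L ^ k) (fun B' => expNegH (-(Ht)) B' φ) (B \ U) *
            (fluctDefect D.𝒞 H B φ +
              (expNegH (stepOpA (gradCov D.𝒞) H) B φ - 1) * (1 - Complex.exp (-(eval (opB D K) B φ))) -
              (Complex.exp (-(eval (opB D K) B φ)) - 1 + eval (opB D K) B φ)) +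
          bprod (L ^ k) (fun B' => expNegH (Ht) B' φ) (U \ B) *
              bprod (L ^ k) (fun B' => expNegH (-(Ht)) B' φ) (B \ U) *
            fluct D.𝒞 (fun ψ => ∑ Y ∈ ((polys (L ^ k) B).erase B).erase ∅,
              bprod (L ^ k) (fun B' => expNegH H B' ψ - 1) (B \ Y) * K Y ψ) φ)) := by
    refine ContDiff.sum fun B hB' => ?_
    obtain ⟨y, rfl⟩ := hblk B hB'
    exact contDiff_blockSummand_abkm_of_stepKernelBounds (p := p) (r₀ := r₀) (A := A) hd2 hB hLodd hM hkN hδ₀ hδ₁ hh hh0 hMord hp1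
      hA0 D hS y (Ht) hH hC hK hKd hKloc U
  have hF2d : ContDiff ℝ r₀ (fun φ => ∑ X ∈ largePartIndex (L ^ k) L U,
        bprod (L ^ k) (fun B => expNegH (Ht) B φ) (U \ X) *
            bprod (L ^ k) (fun B => expNegH (-(Ht)) B φ) (X \ U) *
          (fluct D.𝒞 (polyP2 (L ^ k) H K X) φ + bprod (L ^ k) (fun B => 1 - expNegH (Ht) B φ) X)) := by
    refine ContDiff.sum fun X hX => ?_
    obtain ⟨hXp, -, -, -⟩ := mem_largePartIndex.1 hX
    exact contDiff_reblockTop_abkm_of_stepKernelBounds hd2 hLodd hM hkN hS hp1 hMord hB hδ₀ hδ₁ hh hh0 hA0 hXp (Ht) hH hC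
      hK hKfac hK0 hKd hKloc U
  have hF3d : ContDiff ℝ r₀ (fun φ => ∑ X ∈ ((polys (L ^ k) univ).filter (fun X => reblock (L ^ k) (L * L ^ k) X = U)).filter
          (fun X => ¬ IsConn X),
        bprod (L ^ k) (fun B => expNegH (Ht) B φ) (U \ X) *
            bprod (L ^ k) (fun B => expNegH (-(Ht)) B φ) (X \ U) *
          (fluct D.𝒞 (polyP2 (L ^ k) H K X) φ + bprod (L ^ k) (fun B => 1 - expNegH (Ht) B φ) X)) := by
    refine ContDiff.sum fun X hX => ?_
    have hXp := hUk X (mem_filter.1 hX).1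
    exact contDiff_reblockTop_abkm_of_stepKernelBounds hd2 hLodd hM hkN hS hp1 hMord hB hδ₀ hδ₁ hh hh0 hA0 hXp (Ht) hH hC
      hK hKfac hK0 hKd hKloc U
  have hF4d : ContDiff ℝ r₀ (fun φ => ∑ X ∈ (polys (L ^ k) univ).filter (fun X => reblock (L ^ k) (L * L ^ k) X = U),
        ∑ X₁ ∈ ((polys (L ^ k) X).erase X).erase ∅,
          bprod (L ^ k) (fun B => expNegH (Ht) B φ) (U \ X) *
            bprod (L ^ k) (fun B => expNegH (-(Ht)) B φ) (X \ U) *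
            (bprod (L ^ k) (fun B => 1 - expNegH (Ht) B φ) X₁ *
              fluct D.𝒞 (polyP2 (L ^ k) H K (X \ X₁)) φ)) := by
    refine ContDiff.sum fun X hX => ContDiff.sum fun X₁ hX₁ => ?_
    have hXp := hUk X hX
    have hX₁p : X₁ ∈ polys (L ^ k) X := mem_of_mem_erase (mem_of_mem_erase hX₁)
    exact contDiff_reblockSub_abkm_of_stepKernelBounds hd2 hLodd hM hkN hS hp1 hMord hB hδ₀ hδ₁ hh hh0 hA0 hXp hX₁p (Ht) hH
      hC hK hKfac hK0 hKd hKloc U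
  have hcdE : ∀ (H₀ : RelevantHamiltonian ℂ d) (Z : Finset (Fin d → ZMod M)),
      ContDiff ℝ r₀ (fun φ : (Fin d → ZMod M) → ℝ => bprod (L ^ k) (fun B => expNegH H₀ B φ) Z) := by
    intro H₀ Z
    unfold TorusPolymer.bprod
    exact contDiff_prod fun B _ => (contDiff_eval H₀ B (n := r₀)).neg.cexp
  have hexpd : ∀ (H₀ : RelevantHamiltonian ℂ d) (B : Finset (Fin d → ZMod M)), ContDiff ℝ r₀ (expNegH H₀ B) := by
    intro H₀ B
    show ContDiff ℝ r₀ (fun φ : (Fin d → ZMod M) → ℝ => Complex.exp (-(eval H₀ B φ)))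
    exact (contDiff_eval H₀ B (n := r₀)).neg.cexp
  have hF5d : ContDiff ℝ r₀ (fun φ => ∑ B ∈ blockPartIndex D U,
        bprod (L ^ k) (fun B' => expNegH Ht B' φ) (U \ B) *
            bprod (L ^ k) (fun B' => expNegH (-Ht) B' φ) (B \ U) *
          (expNegH (nextH D H K) B φ - expNegH Ht B φ)) := by
    refine ContDiff.sum fun B _ => ?_
    exact ((hcdE Ht (U \ B)).mul (hcdE (-Ht) (B \ U))).mul ((hexpd (nextH D H K) B).sub (hexpd Ht B))
  have hdec := nextK_freeHt_eq_blockPart_add_remainders_abkm_of_stepKernelBounds (p := p) (r₀ := r₀) (A := A) hd2 hLodd hL hM hkN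
    hp1 hpR hMord hB hδ₀ hδ₁ hh hh0 hA0 D hDs hDL hS hB₀ hc₀ hH Ht hC hK hKfac hK0 hKd hKloc hUne
  have hfun : nextK D.s (reblock D.s (D.L * D.s)) (stepMeasure D.𝒞) (expNegH H) (expNegH Ht) K U =
      (fun φ => blockPart D K U φ) + (fun φ => ∑ B ∈ blockPartIndex D U,
        ((bprod (L ^ k) (fun B' => expNegH (Ht) B' φ) (U \ B) *
              bprod (L ^ k) (fun B' => expNegH (-(Ht)) B' φ) (B \ U) - 1) * blockTerm D K B φ +
          bprod (L ^ k) (fun B' => expNegH (Ht) B' φ) (U \ B) *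
              bprod (L ^ k) (fun B' => expNegH (-(Ht)) B' φ) (B \ U) *
            (fluctDefect D.𝒞 H B φ +
              (expNegH (stepOpA (gradCov D.𝒞) H) B φ - 1) * (1 - Complex.exp (-(eval (opB D K) B φ))) -
              (Complex.exp (-(eval (opB D K) B φ)) - 1 + eval (opB D K) B φ)) +
          bprod (L ^ k) (fun B' => expNegH (Ht) B' φ) (U \ B) *
              bprod (L ^ k) (fun B' => expNegH (-(Ht)) B' φ) (B \ U) *
            fluct D.𝒞 (fun ψ => ∑ Y ∈ ((polys (L ^ k) B).erase B).erase ∅,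
              bprod (L ^ k) (fun B' => expNegH H B' ψ - 1) (B \ Y) * K Y ψ) φ)) + (fun φ => ∑ X ∈ largePartIndex (L ^ k) L U,
        bprod (L ^ k) (fun B => expNegH (Ht) B φ) (U \ X) *
            bprod (L ^ k) (fun B => expNegH (-(Ht)) B φ) (X \ U) *
          (fluct D.𝒞 (polyP2 (L ^ k) H K X) φ + bprod (L ^ k) (fun B => 1 - expNegH (Ht) B φ) X)) + (fun φ => ∑ X ∈ ((polys (L ^ k) univ).filter (fun X => reblock (L ^ k) (L * L ^ k) X = U)).filter
          (fun X => ¬ IsConn X),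
        bprod (L ^ k) (fun B => expNegH (Ht) B φ) (U \ X) *
            bprod (L ^ k) (fun B => expNegH (-(Ht)) B φ) (X \ U) *
          (fluct D.𝒞 (polyP2 (L ^ k) H K X) φ + bprod (L ^ k) (fun B => 1 - expNegH (Ht) B φ) X)) + (fun φ => ∑ X ∈ (polys (L ^ k) univ).filter (fun X => reblock (L ^ k) (L * L ^ k) X = U),
        ∑ X₁ ∈ ((polys (L ^ k) X).erase X).erase ∅,
          bprod (L ^ k) (fun B => expNegH (Ht) B φ) (U \ X) *
            bprod (L ^ k) (fun B => expNegH (-(Ht)) B φ) (X \ U) *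
            (bprod (L ^ k) (fun B => 1 - expNegH (Ht) B φ) X₁ *
              fluct D.𝒞 (polyP2 (L ^ k) H K (X \ X₁)) φ)) + (fun φ => ∑ B ∈ blockPartIndex D U,
        bprod (L ^ k) (fun B' => expNegH Ht B' φ) (U \ B) *
            bprod (L ^ k) (fun B' => expNegH (-Ht) B' φ) (B \ U) *
          (expNegH (nextH D H K) B φ - expNegH Ht B φ)) := by
    funext ψ
    simp only [Pi.add_apply]
    exact hdec ψ
  rw [hfun]
  exact ((((hF0d.add hF1d).add hF2d).add hF3d).add hF4d).add hF5d

end Literature.MathematicalPhysics.StatisticalMechanics.GradientRG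

end
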